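import Literature.Probability.Percolation.KozmaNitzanPhiSuperadditive
import HarnessLib

/-!
# `NoHeavyLowerTail` (stmt-CriticalPhenomena-4575) — the principal constraint of the (GΨ₃) certificate
# (`κ ≥ φE1 + φE2`: Kozma–Nitzan's Lemma 2 for three relays, conditioned through `{x ↔ y}`)

Support file (`--supports stmt-CriticalPhenomena-4575`), coupling seat `prim-cplus-coupling` (gen 7).  No
definitions, no named facts, no sorries.

Context (seat memos A5-COUPLING-gen5.md §4(c), A5-COUPLING-gen7.md §0.5).  The dual certificate
`t* = φE1/(φE1+φE2)` for (GΨ₃) passes the two principal up-sets `{C ∋ x}`, `{C ∋ y}` iff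
`κ := P(o ∈ C(x) | x ↔ y, x ↮ z) ≥ φE1 + φE2`, `φE1 = P(o ↔ x | x ↮ {y,z})`, `φE2 = P(o ↔ y | y ↮ {x,z})`
— this is also the value of the seat's conjecture (P1**) at the up-set `{y ∈ C(x)}`.  It follows from
Kozma–Nitzan's Lemma 2 (tree: `KozmaNitzan2024_lemma2`, blocks `{x}`, `{y}` against `{z}`), which gives
`φE1 + φE2 ≤ P(o ↔ {x,y} | {x,y} ↮ z)`, and one application of the van den Berg–Häggström–Kahn positive
association of the cluster of the SET `{x,y}` given `{x,y} ↮ z` (tree: `KNSep.bhk_set_event_pos`):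
`{o ↔ {x,y}}` and `{x ↔ y}` are increasing events of that cluster, so
`P(o ↔ {x,y} | {x,y} ↮ z) ≤ P(o ↔ {x,y} | {x,y} ↮ z, x ↔ y) = κ`.

* `Q7Psi.conn_pair_pos` — the association step `μ(D ∩ {S ↔ o})·μ(D ∩ {x ↔ y}) ≤ μ(D)·μ(D ∩ {S ↔ o} ∩ {x ↔ y})`,
  `S = {x} ∪ {y}`, `D = {S ↮ z}`;
* `Q7Psi.principal_constraint` — `φ({x}) + φ({y}) ≤ μ(D ∩ {S ↔ o} ∩ {x↔y}) / μ(D ∩ {x ↔ y})` (= `κ`), in the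
  set-builder conventions of `KozmaNitzan2024_lemma2`, assuming the two denominators of that lemma and `μ(D ∩ {x↔y})`
  are non-zero;
* `Q7Psi.principal_constraint_M`, `Q7Psi.principal_constraint_M_single` (appended) — the SHARP form
  `P(o↔X | M) + P(o↔Y | M) ≤ κ` (`M` = all three parts separated), which is the principal-up-set case of the
  covariance comparison (P1-M) with its sharp constant `P(o↔y | M)`.
[cite: KozmaNitzan2024, Lemma 2 (p. 6)] [cite: VandenbergHaggstromKahn2005, Thm 1.3 with Remark 1 after Thm 1.2 (pp. 5–6)]
-/

namespace Summit.CriticalPhenomena.PercolationContinuityZ3.Theorems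

open MeasureTheory Set Literature.Probability.LatticeModels Literature.Probability.Percolation
open scoped Classical

noncomputable section

namespace Q7Psi

variable {V : Type*} [Fintype V]

/-- **Association step**: with `S = X ∪ Y` and `D = {S ↮ Z}`, the increasing events `{S ↔ o}` and
`{x ↔ y}` (`x ∈ S`) of the cluster of `S` are positively correlated given `D`:
`μ(D ∩ {S↔o}) · μ(D ∩ {x↔y}) ≤ μ(D) · μ(D ∩ ({S↔o} ∩ {x↔y}))`.
[cite: VandenbergHaggstromKahn2005, Thm 1.3 (p. 6) and Remark 1 (p. 5)] -/
theorem conn_pair_pos (w : Sym2 V → unitInterval) (X Y Z : Set V) (o x y : V) (hx : x ∈ X ∪ Y) :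
    (prodBernoulli w).real ({ω : BondConfig V | ∀ s ∈ X ∪ Y, ∀ t ∈ Z, ¬ (openGraph ω).Reachable s t} ∩
        {ω | ∃ s ∈ X ∪ Y, (openGraph ω).Reachable s o}) *
      (prodBernoulli w).real ({ω : BondConfig V | ∀ s ∈ X ∪ Y, ∀ t ∈ Z, ¬ (openGraph ω).Reachable s t} ∩
        {ω | (openGraph ω).Reachable x y}) ≤
    (prodBernoulli w).real {ω : BondConfig V | ∀ s ∈ X ∪ Y, ∀ t ∈ Z, ¬ (openGraph ω).Reachable s t} *
      (prodBernoulli w).real ({ω : BondConfig V | ∀ s ∈ X ∪ Y, ∀ t ∈ Z, ¬ (openGraph ω).Reachable s t} ∩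
        ({ω | ∃ s ∈ X ∪ Y, (openGraph ω).Reachable s o} ∩ {ω | (openGraph ω).Reachable x y})) := by
  have key := KNSep.bhk_set_event_pos w (X ∪ Y) Z
    (fun C _ => ∃ s ∈ X ∪ Y, (openGraph C).Reachable s o)
    (fun C _ => (openGraph C).Reachable x y)
    (fun D C C' hCC' h => by
      obtain ⟨s, hs, hso⟩ := h
      exact ⟨s, hs, hso.mono (openGraph_mono hCC')⟩)
    (fun C D D' hDD' h => h)
    (fun D C C' hCC' h => h.mono (openGraph_mono hCC'))
    (fun C D D' hDD' h => h)
  have hP : {ω : BondConfig V | ∃ s ∈ X ∪ Y, (openGraph (⋃ t ∈ X ∪ Y, openEdgeCluster ω t)).Reachable s o} =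
      {ω | ∃ s ∈ X ∪ Y, (openGraph ω).Reachable s o} := by
    ext ω; exact (KNLemma2.conn_iff_cluster ω (X ∪ Y) o).symm
  have hQ : {ω : BondConfig V | (openGraph (⋃ t ∈ X ∪ Y, openEdgeCluster ω t)).Reachable x y} =
      {ω | (openGraph ω).Reachable x y} := by
    ext ω; exact (KNSep.reachable_iff_cluster ω (X ∪ Y) hx y).symm
  simp only [hP, hQ] at key
  exact key

/-- **The principal constraint `κ ≥ φE1 + φE2` of the (GΨ₃) certificate** (three single relays, in the
set-builder form of `KozmaNitzan2024_lemma2` with blocks `X = {x}`, `Y = {y}`, rest `Z = {z}`):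
`φ(X) + φ(Y) ≤ μ(D ∩ {X∪Y ↔ o} ∩ {x ↔ y}) / μ(D ∩ {x ↔ y})`, `D = {X ∪ Y ↮ Z}` — i.e. with singletons,
`P(o↔x | x↮{y,z}) + P(o↔y | y↮{x,z}) ≤ P(o ∈ C(x) | x↔y, {x,y}↮z)`.  Kozma–Nitzan's Lemma 2 gives
`φ(X) + φ(Y) ≤ φ(X ∪ Y) = μ(D ∩ {X∪Y↔o})/μ(D)`, and `conn_pair_pos` upgrades the right side to the
conditioning on `{x ↔ y}`.
[cite: KozmaNitzan2024, Lemma 2 (p. 6)] [cite: VandenbergHaggstromKahn2005, Thm 1.3 (p. 6)] -/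
theorem principal_constraint (w : Sym2 V → unitInterval) (X Y Z : Set V) (o x y : V) (hx : x ∈ X ∪ Y)
    (hM : (prodBernoulli w).real ({ω : BondConfig V | ∀ s ∈ X, ∀ t ∈ Y ∪ Z, ¬ (openGraph ω).Reachable s t} ∩
        {ω | ∀ s ∈ Y, ∀ t ∈ Z, ¬ (openGraph ω).Reachable s t}) ≠ 0)
    (hF : (prodBernoulli w).real ({ω : BondConfig V | ∀ s ∈ X ∪ Y, ∀ t ∈ Z, ¬ (openGraph ω).Reachable s t} ∩
        {ω | (openGraph ω).Reachable x y}) ≠ 0) :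
    (prodBernoulli w).real ({ω : BondConfig V | ∃ s ∈ X, (openGraph ω).Reachable s o} ∩
          {ω | ∀ s ∈ X, ∀ t ∈ Y ∪ Z, ¬ (openGraph ω).Reachable s t}) /
        (prodBernoulli w).real {ω : BondConfig V | ∀ s ∈ X, ∀ t ∈ Y ∪ Z, ¬ (openGraph ω).Reachable s t} +
      (prodBernoulli w).real ({ω : BondConfig V | ∃ s ∈ Y, (openGraph ω).Reachable s o} ∩
          {ω | ∀ s ∈ Y, ∀ t ∈ X ∪ Z, ¬ (openGraph ω).Reachable s t}) /
        (prodBernoulli w).real {ω : BondConfig V | ∀ s ∈ Y, ∀ t ∈ X ∪ Z, ¬ (openGraph ω).Reachable s t} ≤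
    (prodBernoulli w).real ({ω : BondConfig V | ∀ s ∈ X ∪ Y, ∀ t ∈ Z, ¬ (openGraph ω).Reachable s t} ∩
          ({ω | ∃ s ∈ X ∪ Y, (openGraph ω).Reachable s o} ∩ {ω | (openGraph ω).Reachable x y})) /
      (prodBernoulli w).real ({ω : BondConfig V | ∀ s ∈ X ∪ Y, ∀ t ∈ Z, ¬ (openGraph ω).Reachable s t} ∩
          {ω | (openGraph ω).Reachable x y}) := by
  set μ := prodBernoulli w with hμ
  set DXY : Set (BondConfig V) := {ω | ∀ s ∈ X ∪ Y, ∀ t ∈ Z, ¬ (openGraph ω).Reachable s t} with hDXY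
  set CXY : Set (BondConfig V) := {ω | ∃ s ∈ X ∪ Y, (openGraph ω).Reachable s o} with hCXY
  set Q : Set (BondConfig V) := {ω | (openGraph ω).Reachable x y} with hQ
  have h2 := KozmaNitzan2024_lemma2 w X Y Z o hM
  have hpos := conn_pair_pos w X Y Z o x y hx
  change μ.real (DXY ∩ CXY) * μ.real (DXY ∩ Q) ≤ μ.real DXY * μ.real (DXY ∩ (CXY ∩ Q)) at hpos
  -- `φ(X ∪ Y) ≤ μ(D ∩ C ∩ Q)/μ(D ∩ Q)`
  have hFpos : 0 < μ.real (DXY ∩ Q) := lt_of_le_of_ne measureReal_nonneg (Ne.symm hF)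
  have hDpos : 0 < μ.real DXY := lt_of_lt_of_le hFpos (measureReal_mono inter_subset_left)
  have hstep : μ.real (CXY ∩ DXY) / μ.real DXY ≤ μ.real (DXY ∩ (CXY ∩ Q)) / μ.real (DXY ∩ Q) := by
    rw [div_le_div_iff₀ hDpos hFpos, inter_comm CXY DXY]
    linarith
  exact h2.trans hstep

/-- **The SHARP principal constraint (`κ ≥ φ_M(X) + φ_M(Y)` with `M`-conditioned attachment ratios).**  With
`M = {X ↮ Y∪Z} ∩ {Y ↮ Z}` (the three parts mutually separated) and `D = {X∪Y ↮ Z}`: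
`(μ({o↔X} ∩ M) + μ({o↔Y} ∩ M)) / μ(M) ≤ μ(D ∩ {o↔X∪Y} ∩ {x↔y}) / μ(D ∩ {x↔y})` for `x ∈ X ∪ Y`.
This is the intermediate quantity of Kozma–Nitzan's proof of Lemma 2 (`P(o↔X | M) + P(o↔Y | M) = P(o↔X∪Y | M)
≤ φ(X∪Y)`, their Lemma 1(ii)) followed by the association step `conn_pair_pos`; since `φ(X) ≤ P(o↔X | M)`
(their Lemma 1(i)) it refines `principal_constraint`.  With singletons `X={x}, Y={y}, Z={z}` it reads
`P(o↔x | M) + P(o↔y | M) ≤ P(o ∈ C(x) | x↔y, x↮z)`, i.e. the value at the principal up-set `{y ∈ C(x)}` of the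
covariance comparison `Cov(𝟙_U, 𝟙{o∈C x} | x↮z) ≥ P(o↔y | M)·Cov(𝟙_U, 𝟙{y∈C x} | x↮z)` with its sharp constant
`P(o↔y | M)` (seat memo A5-COUPLING-gen7.md §7).
[cite: KozmaNitzan2024, Lemma 1(ii) and proof of Lemma 2 (p. 6)] [cite: VandenbergHaggstromKahn2005, Thm 1.3 (p. 6)] -/
theorem principal_constraint_M (w : Sym2 V → unitInterval) (X Y Z : Set V) (o x y : V) (hx : x ∈ X ∪ Y)
    (hM : (prodBernoulli w).real ({ω : BondConfig V | ∀ s ∈ X, ∀ t ∈ Y ∪ Z, ¬ (openGraph ω).Reachable s t} ∩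
        {ω | ∀ s ∈ Y, ∀ t ∈ Z, ¬ (openGraph ω).Reachable s t}) ≠ 0)
    (hF : (prodBernoulli w).real ({ω : BondConfig V | ∀ s ∈ X ∪ Y, ∀ t ∈ Z, ¬ (openGraph ω).Reachable s t} ∩
        {ω | (openGraph ω).Reachable x y}) ≠ 0) :
    ((prodBernoulli w).real ({ω : BondConfig V | ∃ s ∈ X, (openGraph ω).Reachable s o} ∩
          ({ω : BondConfig V | ∀ s ∈ X, ∀ t ∈ Y ∪ Z, ¬ (openGraph ω).Reachable s t} ∩
            {ω | ∀ s ∈ Y, ∀ t ∈ Z, ¬ (openGraph ω).Reachable s t})) +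
        (prodBernoulli w).real ({ω : BondConfig V | ∃ s ∈ Y, (openGraph ω).Reachable s o} ∩
          ({ω : BondConfig V | ∀ s ∈ X, ∀ t ∈ Y ∪ Z, ¬ (openGraph ω).Reachable s t} ∩
            {ω | ∀ s ∈ Y, ∀ t ∈ Z, ¬ (openGraph ω).Reachable s t}))) /
        (prodBernoulli w).real ({ω : BondConfig V | ∀ s ∈ X, ∀ t ∈ Y ∪ Z, ¬ (openGraph ω).Reachable s t} ∩
          {ω | ∀ s ∈ Y, ∀ t ∈ Z, ¬ (openGraph ω).Reachable s t}) ≤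
    (prodBernoulli w).real ({ω : BondConfig V | ∀ s ∈ X ∪ Y, ∀ t ∈ Z, ¬ (openGraph ω).Reachable s t} ∩
          ({ω | ∃ s ∈ X ∪ Y, (openGraph ω).Reachable s o} ∩ {ω | (openGraph ω).Reachable x y})) /
      (prodBernoulli w).real ({ω : BondConfig V | ∀ s ∈ X ∪ Y, ∀ t ∈ Z, ¬ (openGraph ω).Reachable s t} ∩
          {ω | (openGraph ω).Reachable x y}) := by
  set μ := prodBernoulli w with hμ
  set CX : Set (BondConfig V) := {ω | ∃ s ∈ X, (openGraph ω).Reachable s o} with hCX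
  set CY : Set (BondConfig V) := {ω | ∃ s ∈ Y, (openGraph ω).Reachable s o} with hCY
  set CXY : Set (BondConfig V) := {ω | ∃ s ∈ X ∪ Y, (openGraph ω).Reachable s o} with hCXY
  set DX : Set (BondConfig V) := {ω | ∀ s ∈ X, ∀ t ∈ Y ∪ Z, ¬ (openGraph ω).Reachable s t} with hDX
  set DXY : Set (BondConfig V) := {ω | ∀ s ∈ X ∪ Y, ∀ t ∈ Z, ¬ (openGraph ω).Reachable s t} with hDXY
  set SXY : Set (BondConfig V) := {ω | ∀ s ∈ X, ∀ t ∈ Y, ¬ (openGraph ω).Reachable s t} with hSXY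
  set SXZ : Set (BondConfig V) := {ω | ∀ s ∈ X, ∀ t ∈ Z, ¬ (openGraph ω).Reachable s t} with hSXZ
  set SYZ : Set (BondConfig V) := {ω | ∀ s ∈ Y, ∀ t ∈ Z, ¬ (openGraph ω).Reachable s t} with hSYZ
  set Q : Set (BondConfig V) := {ω | (openGraph ω).Reachable x y} with hQ
  set M : Set (BondConfig V) := DX ∩ SYZ with hMdef
  have hDX' : DX = SXY ∩ SXZ := KNLemma2.sep_union_eq X Y Z
  have hDXY' : DXY = SXZ ∩ SYZ := KNLemma2.union_sep_eq X Y Z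
  have hM_XY : DXY ∩ SXY = M := by
    rw [hMdef, hDX', hDXY']; ext ω; simp only [Set.mem_inter_iff]; tauto
  have hMsub : M ⊆ SXY := by
    rw [hMdef, hDX']; intro ω hω; exact hω.1.1
  -- disjointness under `M`: `μ(CX ∩ M) + μ(CY ∩ M) = μ(CXY ∩ M)`
  have hsum : μ.real (CX ∩ M) + μ.real (CY ∩ M) = μ.real (CXY ∩ M) :=
    (KNLemma2.conn_union_inter_eq μ X Y o M hMsub).symm
  -- Lemma 1(ii): `μ(DXY) μ(CXY ∩ M) ≤ μ(DXY ∩ CXY) μ(M)`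
  have h1ii := KNLemma2.sep_mul_conn_le w X Y Z o
  change μ.real DXY * μ.real (DXY ∩ (CXY ∩ SXY)) ≤ μ.real (DXY ∩ CXY) * μ.real (DXY ∩ SXY) at h1ii
  have hCM : DXY ∩ (CXY ∩ SXY) = CXY ∩ M := by
    rw [← hM_XY]; ext ω; simp only [Set.mem_inter_iff]; tauto
  rw [hCM, hM_XY] at h1ii
  -- association: `μ(DXY ∩ CXY) μ(DXY ∩ Q) ≤ μ(DXY) μ(DXY ∩ (CXY ∩ Q))`
  have hpos := conn_pair_pos w X Y Z o x y hx
  change μ.real (DXY ∩ CXY) * μ.real (DXY ∩ Q) ≤ μ.real DXY * μ.real (DXY ∩ (CXY ∩ Q)) at hpos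
  have hMpos : 0 < μ.real M := lt_of_le_of_ne measureReal_nonneg (Ne.symm hM)
  have hFpos : 0 < μ.real (DXY ∩ Q) := lt_of_le_of_ne measureReal_nonneg (Ne.symm hF)
  have hDpos : 0 < μ.real DXY := lt_of_lt_of_le hFpos (measureReal_mono inter_subset_left)
  rw [hsum]
  have hstep1 : μ.real (CXY ∩ M) / μ.real M ≤ μ.real (DXY ∩ CXY) / μ.real DXY := by
    rw [div_le_div_iff₀ hMpos hDpos]
    linarith
  have hstep2 : μ.real (DXY ∩ CXY) / μ.real DXY ≤ μ.real (DXY ∩ (CXY ∩ Q)) / μ.real (DXY ∩ Q) := by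
    rw [div_le_div_iff₀ hDpos hFpos]
    linarith
  exact hstep1.trans hstep2

/-- **Singleton form of the sharp principal constraint** (three single relays `x, y, z`, observer `o`):
`(μ(x↔o ∩ M) + μ(y↔o ∩ M)) · μ({x↔y} ∩ {x↮z}) ≤ μ({x↔o} ∩ {x↔y} ∩ {x↮z}) · μ(M)`,
`M = {x↮y} ∩ {x↮z} ∩ {y↮z}` — i.e. `P(o↔x | M) + P(o↔y | M) ≤ P(o ∈ C(x) | x↔y, x↮z)`: the principal
up-set `U = {y ∈ C(x)}` case of the covariance comparison (P1-M) with its sharp constant `P(o↔y | M)`.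
[cite: KozmaNitzan2024, Lemma 1(ii), Lemma 2 (p. 6)] [cite: VandenbergHaggstromKahn2005, Thm 1.3 (p. 6)] -/
theorem principal_constraint_M_single (w : Sym2 V → unitInterval) (o x y z : V) :
    ((prodBernoulli w).real (openConn x o ∩ ({ω : BondConfig V | ¬ (openGraph ω).Reachable x y} ∩
          {ω | ¬ (openGraph ω).Reachable x z} ∩ {ω | ¬ (openGraph ω).Reachable y z})) +
        (prodBernoulli w).real (openConn y o ∩ ({ω : BondConfig V | ¬ (openGraph ω).Reachable x y} ∩
          {ω | ¬ (openGraph ω).Reachable x z} ∩ {ω | ¬ (openGraph ω).Reachable y z}))) *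
      (prodBernoulli w).real (openConn x y ∩ {ω : BondConfig V | ¬ (openGraph ω).Reachable x z}) ≤
    (prodBernoulli w).real (openConn x o ∩ openConn x y ∩ {ω : BondConfig V | ¬ (openGraph ω).Reachable x z}) *
      (prodBernoulli w).real ({ω : BondConfig V | ¬ (openGraph ω).Reachable x y} ∩
          {ω | ¬ (openGraph ω).Reachable x z} ∩ {ω | ¬ (openGraph ω).Reachable y z}) := by
  classical
  set μ := prodBernoulli w with hμ
  -- rewrite the singleton set-builder events
  have eCX : {ω : BondConfig V | ∃ s ∈ ({x} : Set V), (openGraph ω).Reachable s o} = openConn x o := by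
    ext ω; simp only [mem_singleton_iff, exists_eq_left, mem_setOf_eq, openConn]
  have eCY : {ω : BondConfig V | ∃ s ∈ ({y} : Set V), (openGraph ω).Reachable s o} = openConn y o := by
    ext ω; simp only [mem_singleton_iff, exists_eq_left, mem_setOf_eq, openConn]
  have eM : ({ω : BondConfig V | ∀ s ∈ ({x} : Set V), ∀ t ∈ ({y} : Set V) ∪ {z}, ¬ (openGraph ω).Reachable s t} ∩
        {ω | ∀ s ∈ ({y} : Set V), ∀ t ∈ ({z} : Set V), ¬ (openGraph ω).Reachable s t}) =
      {ω : BondConfig V | ¬ (openGraph ω).Reachable x y} ∩ {ω | ¬ (openGraph ω).Reachable x z} ∩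
        {ω | ¬ (openGraph ω).Reachable y z} := by
    ext ω
    simp only [singleton_union, mem_insert_iff, mem_singleton_iff, forall_eq_or_imp, forall_eq,
      mem_inter_iff, mem_setOf_eq]
  have eD : {ω : BondConfig V | ∀ s ∈ ({x} : Set V) ∪ {y}, ∀ t ∈ ({z} : Set V), ¬ (openGraph ω).Reachable s t} =
      {ω : BondConfig V | ¬ (openGraph ω).Reachable x z} ∩ {ω | ¬ (openGraph ω).Reachable y z} := by
    ext ω
    simp only [singleton_union, mem_insert_iff, mem_singleton_iff, forall_eq_or_imp, forall_eq,
      mem_inter_iff, mem_setOf_eq]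
  have eCXY : {ω : BondConfig V | ∃ s ∈ ({x} : Set V) ∪ {y}, (openGraph ω).Reachable s o} ∩
        {ω | (openGraph ω).Reachable x y} = openConn x o ∩ openConn x y := by
    ext ω
    simp only [singleton_union, mem_insert_iff, mem_singleton_iff, exists_eq_or_imp, exists_eq_left,
      mem_inter_iff, mem_setOf_eq, openConn]
    constructor
    · rintro ⟨hxo | hyo, hxy⟩
      · exact ⟨hxo, hxy⟩
      · exact ⟨hxy.trans hyo, hxy⟩
    · rintro ⟨hxo, hxy⟩
      exact ⟨Or.inl hxo, hxy⟩
  -- `{x↮z} ∩ {y↮z} ∩ {x↔y} = {x↔y} ∩ {x↮z}` and the numerator event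
  have eDQ : {ω : BondConfig V | ¬ (openGraph ω).Reachable x z} ∩ {ω | ¬ (openGraph ω).Reachable y z} ∩
        {ω | (openGraph ω).Reachable x y} = openConn x y ∩ {ω : BondConfig V | ¬ (openGraph ω).Reachable x z} := by
    ext ω
    simp only [mem_inter_iff, mem_setOf_eq, openConn]
    constructor
    · rintro ⟨⟨hxz, _⟩, hxy⟩; exact ⟨hxy, hxz⟩
    · rintro ⟨hxy, hxz⟩; exact ⟨⟨hxz, fun hyz => hxz (hxy.trans hyz)⟩, hxy⟩
  have eDCQ : {ω : BondConfig V | ¬ (openGraph ω).Reachable x z} ∩ {ω | ¬ (openGraph ω).Reachable y z} ∩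
        (openConn x o ∩ openConn x y) =
      openConn x o ∩ openConn x y ∩ {ω : BondConfig V | ¬ (openGraph ω).Reachable x z} := by
    ext ω
    simp only [mem_inter_iff, mem_setOf_eq, openConn]
    constructor
    · rintro ⟨⟨hxz, _⟩, hxo, hxy⟩; exact ⟨⟨hxo, hxy⟩, hxz⟩
    · rintro ⟨⟨hxo, hxy⟩, hxz⟩; exact ⟨⟨hxz, fun hyz => hxz (hxy.trans hyz)⟩, hxo, hxy⟩
  set Mev : Set (BondConfig V) := {ω : BondConfig V | ¬ (openGraph ω).Reachable x y} ∩
    {ω | ¬ (openGraph ω).Reachable x z} ∩ {ω | ¬ (openGraph ω).Reachable y z} with hMev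
  set Fev : Set (BondConfig V) := openConn x y ∩ {ω : BondConfig V | ¬ (openGraph ω).Reachable x z} with hFev
  set Nev : Set (BondConfig V) := openConn x o ∩ openConn x y ∩ {ω : BondConfig V | ¬ (openGraph ω).Reachable x z}
    with hNev
  show (μ.real (openConn x o ∩ Mev) + μ.real (openConn y o ∩ Mev)) * μ.real Fev ≤ μ.real Nev * μ.real Mev
  by_cases hM : μ.real Mev = 0
  · have h1 : μ.real (openConn x o ∩ Mev) = 0 :=
      le_antisymm ((measureReal_mono inter_subset_right).trans hM.le) measureReal_nonneg
    have h2 : μ.real (openConn y o ∩ Mev) = 0 :=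
      le_antisymm ((measureReal_mono inter_subset_right).trans hM.le) measureReal_nonneg
    rw [h1, h2, hM, add_zero, zero_mul, mul_zero]
  by_cases hF : μ.real Fev = 0
  · rw [hF, mul_zero]; exact mul_nonneg measureReal_nonneg measureReal_nonneg
  have key := principal_constraint_M w ({x} : Set V) {y} {z} o x y (by simp) (by rw [eM]; exact hM)
    (by rw [eD, eDQ]; exact hF)
  rw [eCX, eCY, eM, eD, eCXY, eDQ, eDCQ] at key
  have hMpos : 0 < μ.real Mev := lt_of_le_of_ne measureReal_nonneg (Ne.symm hM)
  have hFpos : 0 < μ.real Fev := lt_of_le_of_ne measureReal_nonneg (Ne.symm hF)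
  rwa [div_le_div_iff₀ hMpos hFpos] at key

end Q7Psi

end

end Summit.CriticalPhenomena.PercolationContinuityZ3.Theorems
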